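import Literature.NumberTheory.DiophantineGeometry.GenEllConjugateCompactnessPlaces
import Literature.NumberTheory.DiophantineGeometry.GenEllConjugatePersistent
import HarnessLib

/-!
# [GenEll] Thm. 2.1, proof, Step "(ii) ⟹ (i)": avoidance, pigeonhole and persistent spines at
# SEVERAL primes (place-indexed forms of `GenEllConjugateAvoidance` / `GenEllConjugatePersistent`)

S. Mochizuki, *Arithmetic elliptic curves in general position*, Math. J. Okayama Univ. 52 (2010),
proof of Theorem 2.1, p. 12 (compactness over the finite set of places `V`, and a noncritical Belyi
map protecting each limit configuration). [cite: MochizukiGenEll2010, Thm 2.1 proof p.12]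

Place-indexed versions (nonarchimedean places `pr : Λ → ℕ`, `Λ` finite; in the `GenEllTwo` assembly
`Λ = {2} ∪ S_bad(e, B)`, contract R-a′ of abc-iut-w5-d045 / owner abc-iut-S6, cell abc-iut) of the
theorems of abc-iut-w5-d081's one-prime files, over `GenEllConjugateCompactnessPlaces`:

* `vojtaIneq_univ_of_avoidance_places` — Vojta in degree `≤ d` for the target `ε` from mechanisms
  with finite bad sets at `∞` and at every `pr l`, carrying Vojta at every margin `r > 0`, that
  EXACTLY avoid every configuration;
* `exists_avoid_of_pairwiseDisjoint_places` — pigeonhole: pairwise disjoint bad sets at each place and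
  MORE THAN `(|Λ| + 1)·d` mechanisms avoid every configuration (`d` slots at `∞`, `d` at each `pr l`);
  `vojtaIneq_univ_of_pairwiseDisjoint_places`, `vojtaIneq_univ_of_coprime_places` (bad sets = roots
  of pairwise coprime `g k ∈ ℚ[X]`, read in `ℂ` and in every `Q̄_{pr l}`);
* `vojtaIneq_univ_of_persistent_places` — the PRIMARY entry point of the `GenEllTwo` assembly under
  R-a′: base maps `i` (the `t_c`-family) with persistent polynomials `Pers i` pairwise coprime and
  more than `(|Λ| + 1)·d` of them; for every `i` and every nonzero `q` coprime to `Pers i` a mechanism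
  with bad polynomial `g` coprime to `q` (exact avoidance, `GenEllConfigurationProtection`) carrying
  Vojta at every margin at `∞` and at every `pr l` ⟹ `VojtaIneq Set.univ d ε`.

Proofs are d081's, one `∀ l` deeper. Theorems only; classical; nothing here bears on anything
disputed.
-/

noncomputable section

open NumberField Set OnePoint Polynomial
open scoped Classical

namespace Literature.NumberTheory.DiophantineGeometry.GenEll

/-- **Vojta in degree `≤ d` from mechanisms with finite bad sets, several primes (avoidance form of
the compactness step).** Mechanisms `k : κ` with finite bad sets `Xarc k ⊆ ℂ` and
`Xnon k l ⊆ Q̄_{pr l}` for every place `l`; (a) for every `k` and margin `r > 0`, Vojta in degree `≤ d`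
on the points all of whose conjugates are `r`-far from the bad sets at `∞` and at every `l`; (b) every
configuration (`d` points of `ℂ ∪ {∞}`, and `d` points of `Q̄_{pr l} ∪ {∞}` for each `l`) avoids the
bad sets of SOME mechanism. Then `VojtaIneq Set.univ d ε`. [cite: MochizukiGenEll2010, Thm 2.1 proof p.12] -/
theorem vojtaIneq_univ_of_avoidance_places {Λ : Type*} [Fintype Λ] (pr : Λ → ℕ)
    [hpr : ∀ l, Fact (pr l).Prime] (d : ℕ) {ε : ℝ} {κ : Type*}
    (Xarc : κ → Finset ℂ) (Xnon : κ → (l : Λ) → Finset (PadicAlgCl (pr l)))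
    (hV : ∀ k (r : ℝ), 0 < r → VojtaIneq {P : NFPoint |
        (∀ σ : P.F →+* ℂ, ∀ a ∈ Xarc k, r < ‖σ P.x - a‖) ∧
        (∀ l, ∀ σ : P.F →+* PadicAlgCl (pr l), ∀ a ∈ Xnon k l, r < ‖σ P.x - a‖)} d ε)
    (havoid : ∀ (a : Fin d → OnePoint ℂ) (b : (l : Λ) → Fin d → OnePoint (PadicAlgCl (pr l))),
      ∃ k : κ, (∀ j, ∀ z ∈ Xarc k, a j ≠ ↑z) ∧ (∀ l j, ∀ z ∈ Xnon k l, b l j ≠ ↑z)) :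
    VojtaIneq Set.univ d ε := by
  refine vojtaIneq_univ_of_monotone_cover_places pr d
    (fun k n => {z : ℂ | ∀ a ∈ Xarc k, ((n : ℝ) + 1)⁻¹ < ‖z - a‖})
    (fun k n => isOpen_setOf_forall_inv_lt_norm_sub (Xarc k) n)
    (fun k l n => {z : PadicAlgCl (pr l) | ∀ a ∈ Xnon k l, ((n : ℝ) + 1)⁻¹ < ‖z - a‖})
    (fun k l n => isOpen_setOf_forall_inv_lt_norm_sub (Xnon k l) n)
    Set.univ (fun _ => Set.univ)
    (fun k _ n => exists_forall_inv_lt_norm_sub_of_lt_norm (Xarc k) n)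
    (fun l k _ n => exists_forall_inv_lt_norm_sub_of_lt_norm (Xnon k l) n)
    (fun k n => setOf_forall_inv_lt_norm_sub_mono (Xarc k) n)
    (fun k l n => setOf_forall_inv_lt_norm_sub_mono (Xnon k l) n)
    ?_ ?_
  · -- exact avoidance of a configuration produces the qualitative cover
    intro a b
    obtain ⟨k, ha, hb⟩ := havoid a b
    refine ⟨k, fun j => ?_, fun l j => ?_⟩
    · induction hj : a j using OnePoint.rec with
      | infty => exact Or.inr ⟨rfl, Set.mem_univ k⟩
      | coe z =>
        have hz : ∀ w ∈ Xarc k, z ≠ w := fun w hw hzw => ha j w hw (by rw [hj, hzw])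
        obtain ⟨n, hn⟩ := exists_forall_inv_lt_norm_sub_of_forall_ne (Xarc k) hz
        exact Or.inl ⟨n, z, hn, rfl⟩
    · induction hj : b l j using OnePoint.rec with
      | infty => exact Or.inr ⟨rfl, Set.mem_univ k⟩
      | coe z =>
        have hz : ∀ w ∈ Xnon k l, z ≠ w := fun w hw hzw => hb l j w hw (by rw [hj, hzw])
        obtain ⟨n, hn⟩ := exists_forall_inv_lt_norm_sub_of_forall_ne (Xnon k l) hz
        exact Or.inl ⟨n, z, hn, rfl⟩
  · -- the Vojta inequality on each margin set
    intro k n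
    exact hV k (((n : ℝ) + 1)⁻¹) (by positivity)

/-- **Pigeonhole, several primes.** If finitely many mechanisms have pairwise disjoint bad sets at
`∞` and at every place `l`, and there are MORE THAN `(|Λ| + 1)·d` of them, then every configuration
(`d` slots at `∞`, `d` slots at each of the `|Λ|` primes) avoids the bad sets of one of them: each slot
meets the bad sets of at most one mechanism. [cite: MochizukiGenEll2010, Thm 2.1 proof p.12] -/
theorem exists_avoid_of_pairwiseDisjoint_places {Λ : Type*} [Fintype Λ] (pr : Λ → ℕ)
    [hpr : ∀ l, Fact (pr l).Prime] (d : ℕ) {κ : Type*} [Fintype κ]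
    (Xarc : κ → Finset ℂ) (Xnon : κ → (l : Λ) → Finset (PadicAlgCl (pr l)))
    (hdisjArc : Pairwise fun i j => Disjoint (Xarc i) (Xarc j))
    (hdisjNon : ∀ l, Pairwise fun i j => Disjoint (Xnon i l) (Xnon j l))
    (hcard : (Fintype.card Λ + 1) * d < Fintype.card κ)
    (a : Fin d → OnePoint ℂ) (b : (l : Λ) → Fin d → OnePoint (PadicAlgCl (pr l))) :
    ∃ k : κ, (∀ j, ∀ z ∈ Xarc k, a j ≠ ↑z) ∧ (∀ l j, ∀ z ∈ Xnon k l, b l j ≠ ↑z) := by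
  classical
  have hκ : Nonempty κ := Fintype.card_pos_iff.mp (lt_of_le_of_lt (Nat.zero_le _) hcard)
  obtain ⟨k₀⟩ := hκ
  -- the (at most one) mechanism whose bad set contains a given entry
  let gA : Fin d → κ := fun j =>
    if h : ∃ k, ∃ z ∈ Xarc k, a j = ↑z then h.choose else k₀
  let gB : Λ × Fin d → κ := fun lj =>
    if h : ∃ k, ∃ z ∈ Xnon k lj.1, b lj.1 lj.2 = ↑z then h.choose else k₀
  let bad : Finset κ := Finset.univ.image gA ∪ Finset.univ.image gB
  have hbad : bad.card ≤ (Fintype.card Λ + 1) * d := by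
    calc bad.card ≤ (Finset.univ.image gA).card + (Finset.univ.image gB).card :=
          Finset.card_union_le _ _
      _ ≤ (Finset.univ : Finset (Fin d)).card + (Finset.univ : Finset (Λ × Fin d)).card :=
          add_le_add Finset.card_image_le Finset.card_image_le
      _ = (Fintype.card Λ + 1) * d := by
          rw [Finset.card_univ, Finset.card_univ, Fintype.card_fin, Fintype.card_prod,
            Fintype.card_fin]
          ring
  have hlt : bad.card < (Finset.univ : Finset κ).card := by
    rw [Finset.card_univ]; exact lt_of_le_of_lt hbad hcard
  obtain ⟨k, -, hk⟩ := Finset.exists_mem_notMem_of_card_lt_card hlt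
  refine ⟨k, fun j z hz hjz => hk ?_, fun l j z hz hjz => hk ?_⟩
  · have hex : ∃ k, ∃ z ∈ Xarc k, a j = ↑z := ⟨k, z, hz, hjz⟩
    obtain ⟨z', hz', hjz'⟩ := hex.choose_spec
    have hzz' : z = z' := OnePoint.coe_injective (hjz.symm.trans hjz')
    have hkk : k = hex.choose := by
      by_contra hne
      have hdis := hdisjArc hne
      rw [hzz'] at hz
      exact Finset.disjoint_left.mp hdis hz hz'
    have hgA : gA j = hex.choose := by simp only [gA, dif_pos hex]
    apply Finset.mem_union_left
    rw [Finset.mem_image]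
    exact ⟨j, Finset.mem_univ j, by rw [hgA, ← hkk]⟩
  · have hex : ∃ k, ∃ z ∈ Xnon k l, b l j = ↑z := ⟨k, z, hz, hjz⟩
    obtain ⟨z', hz', hjz'⟩ := hex.choose_spec
    have hzz' : z = z' := OnePoint.coe_injective (hjz.symm.trans hjz')
    have hkk : k = hex.choose := by
      by_contra hne
      have hdis := hdisjNon l hne
      rw [hzz'] at hz
      exact Finset.disjoint_left.mp hdis hz hz'
    have hgB : gB (l, j) = hex.choose := by simp only [gB, dif_pos hex]
    apply Finset.mem_union_right
    rw [Finset.mem_image]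
    exact ⟨(l, j), Finset.mem_univ _, by rw [hgB, ← hkk]⟩

/-- **Vojta in degree `≤ d` from more than `(|Λ| + 1)·d` mechanisms with pairwise disjoint finite bad
sets at every place** (pigeonhole instance of `vojtaIneq_univ_of_avoidance_places`).
[cite: MochizukiGenEll2010, Thm 2.1 proof p.12] -/
theorem vojtaIneq_univ_of_pairwiseDisjoint_places {Λ : Type*} [Fintype Λ] (pr : Λ → ℕ)
    [hpr : ∀ l, Fact (pr l).Prime] (d : ℕ) {ε : ℝ} {κ : Type*} [Fintype κ]
    (Xarc : κ → Finset ℂ) (Xnon : κ → (l : Λ) → Finset (PadicAlgCl (pr l)))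
    (hdisjArc : Pairwise fun i j => Disjoint (Xarc i) (Xarc j))
    (hdisjNon : ∀ l, Pairwise fun i j => Disjoint (Xnon i l) (Xnon j l))
    (hcard : (Fintype.card Λ + 1) * d < Fintype.card κ)
    (hV : ∀ k (r : ℝ), 0 < r → VojtaIneq {P : NFPoint |
        (∀ σ : P.F →+* ℂ, ∀ a ∈ Xarc k, r < ‖σ P.x - a‖) ∧
        (∀ l, ∀ σ : P.F →+* PadicAlgCl (pr l), ∀ a ∈ Xnon k l, r < ‖σ P.x - a‖)} d ε) :
    VojtaIneq Set.univ d ε :=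
  vojtaIneq_univ_of_avoidance_places pr d Xarc Xnon hV
    (exists_avoid_of_pairwiseDisjoint_places pr d Xarc Xnon hdisjArc hdisjNon hcard)

/-- **Vojta in degree `≤ d` from more than `(|Λ| + 1)·d` mechanisms whose bad sets are the roots of
pairwise coprime rational polynomials**, read at `∞` in `ℂ` and at every place `l` in `Q̄_{pr l}`.
[cite: MochizukiGenEll2010, Thm 2.1 proof p.12] -/
theorem vojtaIneq_univ_of_coprime_places {Λ : Type*} [Fintype Λ] (pr : Λ → ℕ)
    [hpr : ∀ l, Fact (pr l).Prime] (d : ℕ) {ε : ℝ} {κ : Type*} [Fintype κ]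
    (g : κ → ℚ[X]) (hcop : Pairwise fun i j => IsCoprime (g i) (g j))
    (hcard : (Fintype.card Λ + 1) * d < Fintype.card κ)
    (hV : ∀ k (r : ℝ), 0 < r → VojtaIneq {P : NFPoint |
        (∀ σ : P.F →+* ℂ, ∀ a ∈ (g k).aroots ℂ, r < ‖σ P.x - a‖) ∧
        (∀ l, ∀ σ : P.F →+* PadicAlgCl (pr l), ∀ a ∈ (g k).aroots (PadicAlgCl (pr l)),
          r < ‖σ P.x - a‖)} d ε) :
    VojtaIneq Set.univ d ε := by
  classical
  refine vojtaIneq_univ_of_pairwiseDisjoint_places pr d (fun k => ((g k).aroots ℂ).toFinset)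
    (fun k l => ((g k).aroots (PadicAlgCl (pr l))).toFinset)
    (fun i j hij => disjoint_aroots_toFinset_of_isCoprime (hcop hij))
    (fun l i j hij => disjoint_aroots_toFinset_of_isCoprime (hcop hij)) hcard ?_
  intro k r hr
  have hset : {P : NFPoint |
        (∀ σ : P.F →+* ℂ, ∀ a ∈ ((g k).aroots ℂ).toFinset, r < ‖σ P.x - a‖) ∧
        (∀ l, ∀ σ : P.F →+* PadicAlgCl (pr l), ∀ a ∈ ((g k).aroots (PadicAlgCl (pr l))).toFinset,
          r < ‖σ P.x - a‖)} =
      {P : NFPoint |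
        (∀ σ : P.F →+* ℂ, ∀ a ∈ (g k).aroots ℂ, r < ‖σ P.x - a‖) ∧
        (∀ l, ∀ σ : P.F →+* PadicAlgCl (pr l), ∀ a ∈ (g k).aroots (PadicAlgCl (pr l)),
          r < ‖σ P.x - a‖)} := by
    ext P
    simp only [Set.mem_setOf_eq, Multiset.mem_toFinset]
  rw [hset]
  exact hV k r hr

/-- **The persistent spine, several primes — PRIMARY entry point of the `GenEllTwo` assembly under
R-a′.** Base maps `i : ι` (the `t_c`-family), MORE THAN `(|Λ| + 1)·d` of them, with nonzero pairwise
coprime persistent polynomials `Pers i ∈ ℚ[X]` (the unprotectable `x`-sets `X_crit(t_c)`); for every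
`i` and every nonzero `q ∈ ℚ[X]` coprime to `Pers i` (the polynomial of the algebraic entries to be
protected) a mechanism whose bad set is the root set of some `g ∈ ℚ[X]` COPRIME TO `q`
(`GenEllConfigurationProtection`), carrying Vojta in degree `≤ d` at every margin `r > 0` on the
points all of whose conjugates at `∞` and at every `pr l` are `r`-far from the roots of `g`. Then
`VojtaIneq Set.univ d ε`. [cite: MochizukiGenEll2010, Thm 2.1 proof p.12] -/
theorem vojtaIneq_univ_of_persistent_places {Λ : Type*} [Fintype Λ] (pr : Λ → ℕ)
    [hpr : ∀ l, Fact (pr l).Prime] (d : ℕ) {ε : ℝ} {ι : Type*} [Fintype ι]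
    (Pers : ι → ℚ[X]) (hPers0 : ∀ i, Pers i ≠ 0)
    (hPcop : Pairwise fun i j => IsCoprime (Pers i) (Pers j))
    (hcard : (Fintype.card Λ + 1) * d < Fintype.card ι)
    (hmech : ∀ i (c : ℚ[X]), c ≠ 0 → IsCoprime c (Pers i) → ∃ g : ℚ[X], IsCoprime g c ∧
      ∀ r : ℝ, 0 < r → VojtaIneq {P : NFPoint |
        (∀ σ : P.F →+* ℂ, ∀ a ∈ g.aroots ℂ, r < ‖σ P.x - a‖) ∧
        (∀ l, ∀ σ : P.F →+* PadicAlgCl (pr l), ∀ a ∈ g.aroots (PadicAlgCl (pr l)),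
          r < ‖σ P.x - a‖)} d ε) :
    VojtaIneq Set.univ d ε := by
  classical
  choose g hgc hgV using hmech
  -- mechanisms: a base index together with an admissible protection polynomial
  let κ := Σ i : ι, {c : ℚ[X] // c ≠ 0 ∧ IsCoprime c (Pers i)}
  let G : κ → ℚ[X] := fun k => g k.1 k.2.1 k.2.2.1 k.2.2.2
  refine vojtaIneq_univ_of_avoidance_places pr d (κ := κ) (fun k => ((G k).aroots ℂ).toFinset)
    (fun k l => ((G k).aroots (PadicAlgCl (pr l))).toFinset) ?_ ?_
  · -- the Vojta inequality on each margin set (multiset ↔ finset membership)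
    intro k r hr
    have hset : {P : NFPoint |
          (∀ σ : P.F →+* ℂ, ∀ a ∈ ((G k).aroots ℂ).toFinset, r < ‖σ P.x - a‖) ∧
          (∀ l, ∀ σ : P.F →+* PadicAlgCl (pr l),
            ∀ a ∈ ((G k).aroots (PadicAlgCl (pr l))).toFinset, r < ‖σ P.x - a‖)} =
        {P : NFPoint |
          (∀ σ : P.F →+* ℂ, ∀ a ∈ (G k).aroots ℂ, r < ‖σ P.x - a‖) ∧
          (∀ l, ∀ σ : P.F →+* PadicAlgCl (pr l), ∀ a ∈ (G k).aroots (PadicAlgCl (pr l)),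
            r < ‖σ P.x - a‖)} := by
      ext P
      simp only [Set.mem_setOf_eq, Multiset.mem_toFinset]
    rw [hset]
    exact hgV k.1 k.2.1 k.2.2.1 k.2.2.2 r hr
  · -- exact avoidance of every configuration
    intro a b
    -- pigeonhole: a base index whose persistent set contains no entry (at any place)
    obtain ⟨i, hai, hbi⟩ := exists_avoid_of_pairwiseDisjoint_places pr d
      (fun i => ((Pers i).aroots ℂ).toFinset)
      (fun i l => ((Pers i).aroots (PadicAlgCl (pr l))).toFinset)
      (fun i j hij => disjoint_aroots_toFinset_of_isCoprime (hPcop hij))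
      (fun l i j hij => disjoint_aroots_toFinset_of_isCoprime (hPcop hij)) hcard a b
    -- the polynomial of the algebraic entries
    let eA : Fin d → ℚ[X] := fun j =>
      (a j).elim (1 : ℚ[X]) fun z => if IsIntegral ℚ z then minpoly ℚ z else 1
    let eB : Λ × Fin d → ℚ[X] := fun lj =>
      (b lj.1 lj.2).elim (1 : ℚ[X]) fun z => if IsIntegral ℚ z then minpoly ℚ z else 1
    let c : ℚ[X] := (∏ j, eA j) * ∏ lj, eB lj
    have hc0 : c ≠ 0 :=
      mul_ne_zero (Finset.prod_ne_zero_iff.mpr fun j _ => entryPoly_ne_zero (a j))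
        (Finset.prod_ne_zero_iff.mpr fun lj _ => entryPoly_ne_zero (b lj.1 lj.2))
    have hcP : IsCoprime c (Pers i) := by
      refine IsCoprime.mul_left ?_ ?_
      · exact IsCoprime.prod_left fun j _ =>
          isCoprime_entryPoly_of_forall_ne (hPers0 i) (a j)
            (fun w hw => hai j w (Multiset.mem_toFinset.mpr hw))
      · exact IsCoprime.prod_left fun lj _ =>
          isCoprime_entryPoly_of_forall_ne (hPers0 i) (b lj.1 lj.2)
            (fun w hw => hbi lj.1 lj.2 w (Multiset.mem_toFinset.mpr hw))
    have hA : ∀ j, eA j ∣ c := fun j =>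
      (Finset.dvd_prod_of_mem eA (Finset.mem_univ j)).mul_right _
    have hB : ∀ lj, eB lj ∣ c := fun lj =>
      (Finset.dvd_prod_of_mem eB (Finset.mem_univ lj)).mul_left _
    refine ⟨⟨i, c, hc0, hcP⟩, fun j w hw => ?_, fun l j w hw => ?_⟩
    · exact ne_of_mem_aroots_of_isCoprime_entryPoly (a j)
        ((hgc i c hc0 hcP).of_isCoprime_of_dvd_right (hA j)) (Multiset.mem_toFinset.mp hw)
    · exact ne_of_mem_aroots_of_isCoprime_entryPoly (b l j)
        ((hgc i c hc0 hcP).of_isCoprime_of_dvd_right (hB (l, j))) (Multiset.mem_toFinset.mp hw)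

end Literature.NumberTheory.DiophantineGeometry.GenEll

end
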